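import Mathlib.Data.Finset.Card
import Mathlib.Data.Set.Function
import Mathlib.Logic.Function.Basic

/-!
# The two-thread lemma (support file for the robust three-partition matching)

Support file (lineage `prim-bnk-2`, generation 25; `--supports stmt-CriticalPhenomena-4575`; memo
`run/shared/lean/prim/prim-l12/FROM-prim-bnk-2-g25-ROBUST-MATCHING.md` §2).  Pure finite combinatorics: no definitions,
no `sorry`, standard axioms.

**Two-thread lemma (`two_thread`).**  Let `φ₀` be a bijection `N → P` and `φ₁` a bijection `N ⊔ D → P ⊔ X_a ⊔ X_b`
(finite sets inside one type).  Then `D = D_a ⊔ D_b` and there are bijections `α : N ⊔ D_a → P ⊔ X_a`,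
`β : N ⊔ D_b → P ⊔ X_b` which agree pointwise with `φ₀` or `φ₁` on `N` and with `φ₁` on `D_a`, `D_b`; consequently any
relation satisfied by `φ₀` on `N` and by `φ₁` on `N ⊔ D` (e.g. "is increasing") is satisfied by `α` and `β`
(`two_thread_rel`).  This is the combinatorial heart of the inductive step of THEOREM A (one-sided robust Kleitman–Hall
matching on the face poset of the cube, file `…ThreePartitionRobustMatching`): the two "threads" `e ∈ a`, `e ∈ b` of a
coordinate slice share the hopping sources `D`.  Proof: induction on `|N| + |D|` — remove a point `d ∈ D`; if
`φ₁ d ∈ X_a ⊔ X_b` put `d` in the corresponding thread; if `φ₁ d = p ∈ P`, let `n := φ₀⁻¹ p`, apply the induction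
hypothesis to `N − n`, `P − p` with `d` taking over `φ₁ n`, and swap back. [this work]
-/

namespace Summit.CriticalPhenomena.PercolationContinuityZ3.Theorems.ThreePartition

open Finset Function

variable {β : Type*} [DecidableEq β]

/-! ## Small `Set.BijOn` bookkeeping on finite sets -/

/-- A bijection between finite sets preserves cardinality. [folklore] -/
theorem card_eq_of_bijOn {N P : Finset β} {f : β → β} (h : Set.BijOn f ↑N ↑P) : P.card = N.card := by
  classical
  have : P = N.image f := by
    apply Finset.coe_injective
    rw [Finset.coe_image, h.image_eq]
  rw [this, Finset.card_image_of_injOn h.injOn]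

/-- Removing a point from a bijection of finite sets. [folklore] -/
theorem bijOn_erase {N P : Finset β} {f : β → β} (h : Set.BijOn f ↑N ↑P) {n : β} (hn : n ∈ N) :
    Set.BijOn f ↑(N.erase n) ↑(P.erase (f n)) := by
  refine Set.BijOn.mk ?_ ?_ ?_
  · intro x hx
    rw [Finset.coe_erase] at hx ⊢
    refine ⟨h.mapsTo hx.1, ?_⟩
    intro hfx
    rw [Set.mem_singleton_iff] at hfx
    exact hx.2 (by rw [Set.mem_singleton_iff]; exact h.injOn hx.1 hn hfx)
  · exact h.injOn.mono (by rw [Finset.coe_erase]; exact fun x hx => hx.1)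
  · intro y hy
    rw [Finset.coe_erase] at hy
    obtain ⟨x, hx, rfl⟩ := h.surjOn hy.1
    refine ⟨x, ?_, rfl⟩
    rw [Finset.coe_erase]
    exact ⟨hx, fun hxn => hy.2 (by rw [Set.mem_singleton_iff] at hxn ⊢; rw [hxn])⟩

/-- Adding a fresh point to a bijection of finite sets, by updating the function there. [folklore] -/
theorem bijOn_insert_update {N P : Finset β} {f : β → β} (h : Set.BijOn f ↑N ↑P) {n p : β} (hn : n ∉ N)
    (hp : p ∉ P) : Set.BijOn (update f n p) ↑(insert n N) ↑(insert p P) := by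
  have hoff : ∀ x ∈ (N : Set β), update f n p x = f x := fun x hx =>
    update_of_ne (fun hxn => hn (by rw [← hxn]; exact hx)) _ _
  refine Set.BijOn.mk ?_ ?_ ?_
  · intro x hx
    rw [Finset.coe_insert] at hx ⊢
    rcases hx with rfl | hx
    · rw [update_self]; exact Set.mem_insert _ _
    · rw [hoff x hx]; exact Set.mem_insert_of_mem _ (h.mapsTo hx)
  · intro x hx y hy hxy
    rw [Finset.coe_insert] at hx hy
    rcases hx with rfl | hx <;> rcases hy with rfl | hy
    · rfl
    · rw [update_self, hoff y hy] at hxy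
      exact absurd (hxy ▸ h.mapsTo hy) hp
    · rw [update_self, hoff x hx] at hxy
      exact absurd (hxy.symm ▸ h.mapsTo hx) hp
    · rw [hoff x hx, hoff y hy] at hxy
      exact h.injOn hx hy hxy
  · intro y hy
    rw [Finset.coe_insert] at hy
    rcases hy with rfl | hy
    · exact ⟨n, by rw [Finset.coe_insert]; exact Set.mem_insert _ _, update_self _ _ _⟩
    · obtain ⟨x, hx, rfl⟩ := h.surjOn hy
      exact ⟨x, by rw [Finset.coe_insert]; exact Set.mem_insert_of_mem _ hx, hoff x hx⟩

/-- Transport of a bijection along equal source/target finite sets. [folklore] -/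
theorem bijOn_congr_sets {γ : Type*} {N N' P P' : Finset γ} {f : γ → γ} (h : Set.BijOn f ↑N ↑P) (hN : N = N')
    (hP : P = P') : Set.BijOn f ↑N' ↑P' := by subst hN; subst hP; exact h

/-! ## The two-thread lemma -/

/-- Symmetry of the two-thread conclusion in the two threads. [this work] -/
theorem two_thread_swap {N P D Xa Xb : Finset β} {φ₀ φ₁ : β → β}
    (h : ∃ (Da Db : Finset β) (α β' : β → β), Da ∪ Db = D ∧ Disjoint Da Db ∧
      Set.BijOn α ↑(N ∪ Da) ↑(P ∪ Xa) ∧ Set.BijOn β' ↑(N ∪ Db) ↑(P ∪ Xb) ∧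
      (∀ x ∈ N, α x = φ₀ x ∨ α x = φ₁ x) ∧ (∀ x ∈ N, β' x = φ₀ x ∨ β' x = φ₁ x) ∧
      (∀ x ∈ Da, α x = φ₁ x) ∧ (∀ x ∈ Db, β' x = φ₁ x)) :
    ∃ (Da Db : Finset β) (α β' : β → β), Da ∪ Db = D ∧ Disjoint Da Db ∧
      Set.BijOn α ↑(N ∪ Da) ↑(P ∪ Xb) ∧ Set.BijOn β' ↑(N ∪ Db) ↑(P ∪ Xa) ∧
      (∀ x ∈ N, α x = φ₀ x ∨ α x = φ₁ x) ∧ (∀ x ∈ N, β' x = φ₀ x ∨ β' x = φ₁ x) ∧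
      (∀ x ∈ Da, α x = φ₁ x) ∧ (∀ x ∈ Db, β' x = φ₁ x) := by
  obtain ⟨Da, Db, α, β', h1, h2, h3, h4, h5, h6, h7, h8⟩ := h
  exact ⟨Db, Da, β', α, by rw [Finset.union_comm, h1], h2.symm, h4, h3, h6, h5, h8, h7⟩

/-- The case `D = ∅`: then `X_a = X_b = ∅` and both threads use `φ₀`. [this work] -/
theorem two_thread_empty (N P Xa Xb : Finset β) (φ₀ φ₁ : β → β)
    (hPa : Disjoint P Xa) (hPb : Disjoint P Xb) (hab : Disjoint Xa Xb)
    (h0 : Set.BijOn φ₀ ↑N ↑P) (h1 : Set.BijOn φ₁ ↑(N ∪ ∅) ↑(P ∪ Xa ∪ Xb)) :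
    ∃ (Da Db : Finset β) (α β' : β → β), Da ∪ Db = ∅ ∧ Disjoint Da Db ∧
      Set.BijOn α ↑(N ∪ Da) ↑(P ∪ Xa) ∧ Set.BijOn β' ↑(N ∪ Db) ↑(P ∪ Xb) ∧
      (∀ x ∈ N, α x = φ₀ x ∨ α x = φ₁ x) ∧ (∀ x ∈ N, β' x = φ₀ x ∨ β' x = φ₁ x) ∧
      (∀ x ∈ Da, α x = φ₁ x) ∧ (∀ x ∈ Db, β' x = φ₁ x) := by
  rw [Finset.union_empty] at h1
  have hc0 := card_eq_of_bijOn h0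
  have hc1 := card_eq_of_bijOn h1
  rw [card_union_of_disjoint (Finset.disjoint_union_left.2 ⟨hPb, hab⟩),
    card_union_of_disjoint hPa, hc0] at hc1
  have hXa : Xa = ∅ := Finset.card_eq_zero.1 (by omega)
  have hXb : Xb = ∅ := Finset.card_eq_zero.1 (by omega)
  subst hXa; subst hXb
  refine ⟨∅, ∅, φ₀, φ₀, by simp, disjoint_empty_left _, ?_, ?_, fun x _ => Or.inl rfl, fun x _ => Or.inl rfl,
    fun x hx => absurd hx (Finset.notMem_empty x), fun x hx => absurd hx (Finset.notMem_empty x)⟩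
  · rw [Finset.union_empty, Finset.union_empty]; exact h0
  · rw [Finset.union_empty, Finset.union_empty]; exact h0

/-- Induction step, case `φ₁ d ∈ X_a`: put `d` into thread `a`. [this work] -/
theorem two_thread_stepX {N P D Xa Xb : Finset β} {φ₀ φ₁ : β → β} {d : β} (hd : d ∈ D) (hdN : d ∉ N)
    (ht : φ₁ d ∈ Xa) (hPa : Disjoint P Xa)
    (ih : ∃ (Da Db : Finset β) (α β' : β → β), Da ∪ Db = D.erase d ∧ Disjoint Da Db ∧
      Set.BijOn α ↑(N ∪ Da) ↑(P ∪ Xa.erase (φ₁ d)) ∧ Set.BijOn β' ↑(N ∪ Db) ↑(P ∪ Xb) ∧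
      (∀ x ∈ N, α x = φ₀ x ∨ α x = φ₁ x) ∧ (∀ x ∈ N, β' x = φ₀ x ∨ β' x = φ₁ x) ∧
      (∀ x ∈ Da, α x = φ₁ x) ∧ (∀ x ∈ Db, β' x = φ₁ x)) :
    ∃ (Da Db : Finset β) (α β' : β → β), Da ∪ Db = D ∧ Disjoint Da Db ∧
      Set.BijOn α ↑(N ∪ Da) ↑(P ∪ Xa) ∧ Set.BijOn β' ↑(N ∪ Db) ↑(P ∪ Xb) ∧
      (∀ x ∈ N, α x = φ₀ x ∨ α x = φ₁ x) ∧ (∀ x ∈ N, β' x = φ₀ x ∨ β' x = φ₁ x) ∧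
      (∀ x ∈ Da, α x = φ₁ x) ∧ (∀ x ∈ Db, β' x = φ₁ x) := by
  obtain ⟨Da, Db, α, β', hDab, hdisj, hα, hβ, hαN, hβN, hαD, hβD⟩ := ih
  have hdDa : d ∉ Da := fun h => by
    have : d ∈ D.erase d := by rw [← hDab]; exact Finset.mem_union_left _ h
    exact Finset.notMem_erase d D this
  have hdDb : d ∉ Db := fun h => by
    have : d ∈ D.erase d := by rw [← hDab]; exact Finset.mem_union_right _ h
    exact Finset.notMem_erase d D this
  have hdNDa : d ∉ N ∪ Da := fun h => (Finset.mem_union.1 h).elim hdN hdDa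
  have htP : φ₁ d ∉ P ∪ Xa.erase (φ₁ d) := fun h => by
    rcases Finset.mem_union.1 h with h | h
    · exact Finset.disjoint_left.1 hPa h ht
    · exact Finset.notMem_erase _ _ h
  have hα' := bijOn_insert_update hα hdNDa htP
  refine ⟨insert d Da, Db, update α d (φ₁ d), β', ?_, ?_, ?_, hβ, ?_, hβN, ?_, hβD⟩
  · rw [Finset.insert_union, hDab, Finset.insert_erase hd]
  · exact Finset.disjoint_insert_left.2 ⟨hdDb, hdisj⟩
  · refine bijOn_congr_sets hα' ?_ ?_
    · rw [Finset.union_insert]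
    · rw [← Finset.union_insert, Finset.insert_erase ht]
  · intro x hx
    have hxd : x ≠ d := fun h => hdN (h ▸ hx)
    rw [update_of_ne hxd]; exact hαN x hx
  · intro x hx
    rcases Finset.mem_insert.1 hx with rfl | hx
    · rw [update_self]
    · have hxd : x ≠ d := fun h => hdDa (h ▸ hx)
      rw [update_of_ne hxd]; exact hαD x hx

/-- Induction step, case `φ₁ d = φ₀ n = p ∈ P` and the induction hypothesis (for `N − n`, `P − p`, `φ₁[d ↦ φ₁ n]`)
put `d` into thread `a`: swap back (`d ↦ p`, `n ↦ φ₁ n` in thread `a`, `n ↦ p` in thread `b`). [this work] -/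
theorem two_thread_stepP {N P D Xa Xb : Finset β} {φ₀ φ₁ : β → β} {d n : β} (hd : d ∈ D) (hdN : d ∉ N)
    (hn : n ∈ N) (hnD : n ∉ D) (hp : φ₀ n = φ₁ d) (hpP : φ₁ d ∈ P) (hpa : φ₁ d ∉ Xa) (hpb : φ₁ d ∉ Xb)
    (hqp : φ₁ n ≠ φ₁ d)
    {Da Db : Finset β} {α β' : β → β} (hDab : Da ∪ Db = D) (hdisj : Disjoint Da Db)
    (hα : Set.BijOn α ↑(N.erase n ∪ Da) ↑(P.erase (φ₁ d) ∪ Xa)) (hβ : Set.BijOn β' ↑(N.erase n ∪ Db) ↑(P.erase (φ₁ d) ∪ Xb))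
    (hαN : ∀ x ∈ N.erase n, α x = φ₀ x ∨ α x = update φ₁ d (φ₁ n) x)
    (hβN : ∀ x ∈ N.erase n, β' x = φ₀ x ∨ β' x = update φ₁ d (φ₁ n) x)
    (hαD : ∀ x ∈ Da, α x = update φ₁ d (φ₁ n) x) (hβD : ∀ x ∈ Db, β' x = update φ₁ d (φ₁ n) x)
    (hdDa : d ∈ Da) :
    ∃ (Da Db : Finset β) (α β' : β → β), Da ∪ Db = D ∧ Disjoint Da Db ∧
      Set.BijOn α ↑(N ∪ Da) ↑(P ∪ Xa) ∧ Set.BijOn β' ↑(N ∪ Db) ↑(P ∪ Xb) ∧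
      (∀ x ∈ N, α x = φ₀ x ∨ α x = φ₁ x) ∧ (∀ x ∈ N, β' x = φ₀ x ∨ β' x = φ₁ x) ∧
      (∀ x ∈ Da, α x = φ₁ x) ∧ (∀ x ∈ Db, β' x = φ₁ x) := by
  set p := φ₁ d with hpdef
  set q := φ₁ n with hqdef
  have hnd : n ≠ d := fun h => hdN (h ▸ hn)
  have hdDb : d ∉ Db := fun h => Finset.disjoint_left.1 hdisj hdDa h
  have hDaD : Da ⊆ D := by rw [← hDab]; exact Finset.subset_union_left
  have hDbD : Db ⊆ D := by rw [← hDab]; exact Finset.subset_union_right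
  have hnDa : n ∉ Da := fun h => hnD (hDaD h)
  have hnDb : n ∉ Db := fun h => hnD (hDbD h)
  have hαd : α d = q := by rw [hαD d hdDa, update_self]
  -- thread a: erase d (value q), insert d ↦ p, insert n ↦ q
  have hdm : d ∈ N.erase n ∪ Da := Finset.mem_union_right _ hdDa
  have e1 : Set.BijOn α ↑((N.erase n ∪ Da).erase d) ↑((P.erase p ∪ Xa).erase q) := by
    have := bijOn_erase hα hdm; rwa [hαd] at this
  have hpX : p ∉ (P.erase p ∪ Xa).erase q := fun h => by
    rcases Finset.mem_union.1 (Finset.mem_of_mem_erase h) with h | h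
    · exact Finset.notMem_erase p P h
    · exact hpa h
  have e2 := bijOn_insert_update e1 (Finset.notMem_erase d _) hpX
  rw [Finset.insert_erase hdm] at e2
  have hnm : n ∉ N.erase n ∪ Da := fun h => (Finset.mem_union.1 h).elim (Finset.notMem_erase n N) hnDa
  have hqm : q ∉ insert p ((P.erase p ∪ Xa).erase q) := fun h => by
    rcases Finset.mem_insert.1 h with h | h
    · exact hqp h
    · exact Finset.notMem_erase q _ h
  have e3 := bijOn_insert_update e2 hnm hqm
  have hqPX : q ∈ P.erase p ∪ Xa := by rw [← hαd]; exact_mod_cast hα.mapsTo (by exact_mod_cast hdm)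
  -- thread b: insert n ↦ p
  have hnmb : n ∉ N.erase n ∪ Db := fun h => (Finset.mem_union.1 h).elim (Finset.notMem_erase n N) hnDb
  have hpmb : p ∉ P.erase p ∪ Xb := fun h => (Finset.mem_union.1 h).elim (Finset.notMem_erase p P) hpb
  have f1 := bijOn_insert_update hβ hnmb hpmb
  refine ⟨Da, Db, update (update α d p) n q, update β' n p, hDab, hdisj, ?_, ?_, ?_, ?_, ?_, ?_⟩
  · refine bijOn_congr_sets e3 ?_ ?_
    · rw [← Finset.insert_union, Finset.insert_erase hn]
    · rw [Finset.insert_comm, Finset.insert_erase hqPX, ← Finset.insert_union, Finset.insert_erase hpP]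
  · refine bijOn_congr_sets f1 ?_ ?_
    · rw [← Finset.insert_union, Finset.insert_erase hn]
    · rw [← Finset.insert_union, Finset.insert_erase hpP]
  · intro x hx
    by_cases hxn : x = n
    · subst hxn; right; rw [update_self]
    · have hxd : x ≠ d := fun h => hdN (h ▸ hx)
      rw [update_of_ne hxn, update_of_ne hxd]
      rcases hαN x (Finset.mem_erase.2 ⟨hxn, hx⟩) with h | h
      · exact Or.inl h
      · right; rwa [update_of_ne hxd] at h
  · intro x hx
    by_cases hxn : x = n
    · subst hxn; left; rw [update_self, hp]
    · have hxd : x ≠ d := fun h => hdN (h ▸ hx)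
      rw [update_of_ne hxn]
      rcases hβN x (Finset.mem_erase.2 ⟨hxn, hx⟩) with h | h
      · exact Or.inl h
      · right; rwa [update_of_ne hxd] at h
  · intro x hx
    have hxn : x ≠ n := fun h => hnDa (h ▸ hx)
    rw [update_of_ne hxn]
    by_cases hxd : x = d
    · subst hxd; rw [update_self]
    · rw [update_of_ne hxd, hαD x hx, update_of_ne hxd]
  · intro x hx
    have hxn : x ≠ n := fun h => hnDb (h ▸ hx)
    have hxd : x ≠ d := fun h => hdDb (h ▸ hx)
    rw [update_of_ne hxn, hβD x hx, update_of_ne hxd]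

/-- **Two-thread lemma**, with a size parameter for the induction on `|N| + |D|`. [this work] -/
theorem two_thread_aux : ∀ (k : ℕ) (N P D Xa Xb : Finset β) (φ₀ φ₁ : β → β),
    N.card + D.card ≤ k → Disjoint N D → Disjoint P Xa → Disjoint P Xb → Disjoint Xa Xb →
    Set.BijOn φ₀ ↑N ↑P → Set.BijOn φ₁ ↑(N ∪ D) ↑(P ∪ Xa ∪ Xb) →
    ∃ (Da Db : Finset β) (α β' : β → β), Da ∪ Db = D ∧ Disjoint Da Db ∧
      Set.BijOn α ↑(N ∪ Da) ↑(P ∪ Xa) ∧ Set.BijOn β' ↑(N ∪ Db) ↑(P ∪ Xb) ∧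
      (∀ x ∈ N, α x = φ₀ x ∨ α x = φ₁ x) ∧ (∀ x ∈ N, β' x = φ₀ x ∨ β' x = φ₁ x) ∧
      (∀ x ∈ Da, α x = φ₁ x) ∧ (∀ x ∈ Db, β' x = φ₁ x) := by
  intro k
  induction k with
  | zero =>
    intro N P D Xa Xb φ₀ φ₁ hk hND hPa hPb hab h0 h1
    have hD : D = ∅ := Finset.card_eq_zero.1 (by omega)
    subst hD
    exact two_thread_empty N P Xa Xb φ₀ φ₁ hPa hPb hab h0 h1
  | succ k ih =>
    intro N P D Xa Xb φ₀ φ₁ hk hND hPa hPb hab h0 h1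
    by_cases hD : D = ∅
    · subst hD; exact two_thread_empty N P Xa Xb φ₀ φ₁ hPa hPb hab h0 h1
    obtain ⟨d, hd⟩ := Finset.nonempty_iff_ne_empty.2 hD
    have hdN : d ∉ N := fun h => Finset.disjoint_left.1 hND h hd
    have hdND : d ∈ N ∪ D := Finset.mem_union_right _ hd
    have ht : φ₁ d ∈ P ∪ Xa ∪ Xb := by exact_mod_cast h1.mapsTo (by exact_mod_cast hdND)
    -- `φ₁` with `d` removed
    have h1' : Set.BijOn φ₁ ↑(N ∪ D.erase d) ↑((P ∪ Xa ∪ Xb).erase (φ₁ d)) := by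
      refine bijOn_congr_sets (bijOn_erase h1 hdND) ?_ rfl
      rw [Finset.erase_union_distrib, Finset.erase_eq_of_notMem hdN]
    have hcardD : N.card + (D.erase d).card ≤ k := by
      rw [Finset.card_erase_of_mem hd]; have := Finset.card_pos.2 ⟨d, hd⟩; omega
    have hND' : Disjoint N (D.erase d) := Finset.disjoint_of_subset_right (Finset.erase_subset _ _) hND
    rcases Finset.mem_union.1 ht with ht' | htb
    · rcases Finset.mem_union.1 ht' with htP | hta
      · -- CASE `φ₁ d = p ∈ P`: re-route through `n := φ₀⁻¹ p`
        obtain ⟨n, hn, hnp⟩ := h0.surjOn (by exact_mod_cast htP : φ₁ d ∈ (P : Set β))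
        have hn' : n ∈ N := by exact_mod_cast hn
        have hnd : n ≠ d := fun h => hdN (h ▸ hn')
        have hnD : n ∉ D := fun h => Finset.disjoint_left.1 hND hn' h
        have hnND : n ∈ N ∪ D := Finset.mem_union_left _ hn'
        have hqp : φ₁ n ≠ φ₁ d := fun h =>
          hnd (h1.injOn (by exact_mod_cast hnND) (by exact_mod_cast hdND) h)
        have hqS : φ₁ n ∈ P ∪ Xa ∪ Xb := by exact_mod_cast h1.mapsTo (by exact_mod_cast hnND)
        have hpa : φ₁ d ∉ Xa := fun h => Finset.disjoint_left.1 hPa htP h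
        have hpb : φ₁ d ∉ Xb := fun h => Finset.disjoint_left.1 hPb htP h
        have h0r : Set.BijOn φ₀ ↑(N.erase n) ↑(P.erase (φ₁ d)) := by rw [← hnp]; exact bijOn_erase h0 hn'
        have h1r : Set.BijOn (update φ₁ d (φ₁ n)) ↑(N.erase n ∪ D) ↑(P.erase (φ₁ d) ∪ Xa ∪ Xb) := by
          have e1 : Set.BijOn φ₁ ↑((N ∪ D).erase n) ↑((P ∪ Xa ∪ Xb).erase (φ₁ n)) := bijOn_erase h1 hnND
          have hd2 : d ∈ (N ∪ D).erase n := Finset.mem_erase.2 ⟨hnd.symm, hdND⟩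
          have e2 := bijOn_erase e1 hd2
          have e3 := bijOn_insert_update e2 (Finset.notMem_erase d _)
            (show φ₁ n ∉ ((P ∪ Xa ∪ Xb).erase (φ₁ n)).erase (φ₁ d) from
              fun h => Finset.notMem_erase (φ₁ n) _ (Finset.mem_of_mem_erase h))
          refine bijOn_congr_sets e3 ?_ ?_
          · rw [Finset.insert_erase hd2, Finset.erase_union_distrib, Finset.erase_eq_of_notMem hnD]
          · rw [Finset.erase_right_comm, Finset.insert_erase (Finset.mem_erase.2 ⟨hqp, hqS⟩),
              Finset.erase_union_distrib, Finset.erase_union_distrib, Finset.erase_eq_of_notMem hpa,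
              Finset.erase_eq_of_notMem hpb]
        have hcard : (N.erase n).card + D.card ≤ k := by
          rw [Finset.card_erase_of_mem hn']; have := Finset.card_pos.2 ⟨n, hn'⟩; omega
        have hNDr : Disjoint (N.erase n) D := Finset.disjoint_of_subset_left (Finset.erase_subset _ _) hND
        have hPa' : Disjoint (P.erase (φ₁ d)) Xa := Finset.disjoint_of_subset_left (Finset.erase_subset _ _) hPa
        have hPb' : Disjoint (P.erase (φ₁ d)) Xb := Finset.disjoint_of_subset_left (Finset.erase_subset _ _) hPb
        obtain ⟨Da, Db, α, β', hDab, hdisj, hα, hβ, hαN, hβN, hαD, hβD⟩ :=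
          ih (N.erase n) (P.erase (φ₁ d)) D Xa Xb φ₀ (update φ₁ d (φ₁ n)) hcard hNDr hPa' hPb' hab h0r h1r
        have hdD : d ∈ Da ∪ Db := by rw [hDab]; exact hd
        rcases Finset.mem_union.1 hdD with hdDa | hdDb
        · exact two_thread_stepP hd hdN hn' hnD hnp htP hpa hpb hqp hDab hdisj hα hβ hαN hβN hαD hβD hdDa
        · refine two_thread_swap ?_
          exact two_thread_stepP hd hdN hn' hnD hnp htP hpb hpa hqp (by rw [Finset.union_comm, hDab]) hdisj.symm
            hβ hα hβN hαN hβD hαD hdDb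
      · -- CASE `φ₁ d ∈ X_a`
        have hta' : (P ∪ Xa ∪ Xb).erase (φ₁ d) = P ∪ Xa.erase (φ₁ d) ∪ Xb := by
          rw [Finset.erase_union_distrib, Finset.erase_union_distrib,
            Finset.erase_eq_of_notMem (fun h => Finset.disjoint_left.1 hPa h hta),
            Finset.erase_eq_of_notMem (fun h => Finset.disjoint_left.1 hab hta h)]
        rw [hta'] at h1'
        have hPa' : Disjoint P (Xa.erase (φ₁ d)) := Finset.disjoint_of_subset_right (Finset.erase_subset _ _) hPa
        have hab' : Disjoint (Xa.erase (φ₁ d)) Xb := Finset.disjoint_of_subset_left (Finset.erase_subset _ _) hab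
        have ih' := ih N P (D.erase d) (Xa.erase (φ₁ d)) Xb φ₀ φ₁ hcardD hND' hPa' hPb hab' h0 h1'
        exact two_thread_stepX hd hdN hta hPa ih'
    · -- CASE `φ₁ d ∈ X_b` (symmetric)
      have htb' : (P ∪ Xa ∪ Xb).erase (φ₁ d) = P ∪ Xa ∪ Xb.erase (φ₁ d) := by
        rw [Finset.erase_union_distrib, Finset.erase_union_distrib,
          Finset.erase_eq_of_notMem (fun h => Finset.disjoint_left.1 hPb h htb),
          Finset.erase_eq_of_notMem (fun h => Finset.disjoint_left.1 hab h htb)]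
      rw [htb'] at h1'
      have hPb' : Disjoint P (Xb.erase (φ₁ d)) := Finset.disjoint_of_subset_right (Finset.erase_subset _ _) hPb
      have hab' : Disjoint Xa (Xb.erase (φ₁ d)) := Finset.disjoint_of_subset_right (Finset.erase_subset _ _) hab
      have ih' := ih N P (D.erase d) Xa (Xb.erase (φ₁ d)) φ₀ φ₁ hcardD hND' hPa hPb' hab' h0 h1'
      exact two_thread_swap (two_thread_stepX hd hdN htb hPb (two_thread_swap ih'))

/-- **THE TWO-THREAD LEMMA.**  Given bijections `φ₀ : N → P` and `φ₁ : N ⊔ D → P ⊔ X_a ⊔ X_b` of finite sets, there is a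
splitting `D = D_a ⊔ D_b` and bijections `α : N ⊔ D_a → P ⊔ X_a`, `β : N ⊔ D_b → P ⊔ X_b` such that `α x, β x ∈ {φ₀ x, φ₁ x}`
for `x ∈ N`, `α = φ₁` on `D_a` and `β = φ₁` on `D_b`. [this work] -/
theorem two_thread (N P D Xa Xb : Finset β) (φ₀ φ₁ : β → β) (hND : Disjoint N D) (hPa : Disjoint P Xa)
    (hPb : Disjoint P Xb) (hab : Disjoint Xa Xb) (h0 : Set.BijOn φ₀ ↑N ↑P)
    (h1 : Set.BijOn φ₁ ↑(N ∪ D) ↑(P ∪ Xa ∪ Xb)) :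
    ∃ (Da Db : Finset β) (α β' : β → β), Da ∪ Db = D ∧ Disjoint Da Db ∧
      Set.BijOn α ↑(N ∪ Da) ↑(P ∪ Xa) ∧ Set.BijOn β' ↑(N ∪ Db) ↑(P ∪ Xb) ∧
      (∀ x ∈ N, α x = φ₀ x ∨ α x = φ₁ x) ∧ (∀ x ∈ N, β' x = φ₀ x ∨ β' x = φ₁ x) ∧
      (∀ x ∈ Da, α x = φ₁ x) ∧ (∀ x ∈ Db, β' x = φ₁ x) :=
  two_thread_aux _ N P D Xa Xb φ₀ φ₁ le_rfl hND hPa hPb hab h0 h1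

/-- **Two-thread lemma, relational form.**  If `φ₀` on `N` and `φ₁` on `N ⊔ D` satisfy a relation `R x (φ x)` (e.g. both are
increasing maps of a partial order), then so do the thread bijections: there are `D = D_a ⊔ D_b` and bijections
`α : N ⊔ D_a → P ⊔ X_a`, `β : N ⊔ D_b → P ⊔ X_b` with `R x (α x)` on `N ⊔ D_a` and `R x (β x)` on `N ⊔ D_b`. [this work] -/
theorem two_thread_rel (N P D Xa Xb : Finset β) (φ₀ φ₁ : β → β) (R : β → β → Prop) (hND : Disjoint N D)
    (hPa : Disjoint P Xa) (hPb : Disjoint P Xb) (hab : Disjoint Xa Xb) (h0 : Set.BijOn φ₀ ↑N ↑P)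
    (h1 : Set.BijOn φ₁ ↑(N ∪ D) ↑(P ∪ Xa ∪ Xb)) (hR0 : ∀ x ∈ N, R x (φ₀ x)) (hR1 : ∀ x ∈ N ∪ D, R x (φ₁ x)) :
    ∃ (Da Db : Finset β) (α β' : β → β), Da ∪ Db = D ∧ Disjoint Da Db ∧
      Set.BijOn α ↑(N ∪ Da) ↑(P ∪ Xa) ∧ Set.BijOn β' ↑(N ∪ Db) ↑(P ∪ Xb) ∧
      (∀ x ∈ N ∪ Da, R x (α x)) ∧ (∀ x ∈ N ∪ Db, R x (β' x)) := by
  obtain ⟨Da, Db, α, β', hDab, hdisj, hα, hβ, hαN, hβN, hαD, hβD⟩ :=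
    two_thread N P D Xa Xb φ₀ φ₁ hND hPa hPb hab h0 h1
  have hDaD : Da ⊆ D := by rw [← hDab]; exact Finset.subset_union_left
  have hDbD : Db ⊆ D := by rw [← hDab]; exact Finset.subset_union_right
  refine ⟨Da, Db, α, β', hDab, hdisj, hα, hβ, ?_, ?_⟩
  · intro x hx
    rcases Finset.mem_union.1 hx with hx | hx
    · rcases hαN x hx with h | h
      · rw [h]; exact hR0 x hx
      · rw [h]; exact hR1 x (Finset.mem_union_left _ hx)
    · rw [hαD x hx]; exact hR1 x (Finset.mem_union_right _ (hDaD hx))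
  · intro x hx
    rcases Finset.mem_union.1 hx with hx | hx
    · rcases hβN x hx with h | h
      · rw [h]; exact hR0 x hx
      · rw [h]; exact hR1 x (Finset.mem_union_left _ hx)
    · rw [hβD x hx]; exact hR1 x (Finset.mem_union_right _ (hDbD hx))

end Summit.CriticalPhenomena.PercolationContinuityZ3.Theorems.ThreePartition
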